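import Summits.NavierStokesRegularity.NavierStokesRegularity.Theses.SelfMixingDichotomy
import Literature.Analysis.FluidPDE.SereginSverakOffAxisRegularity

/-!
# Route SelfMixingDichotomy — structure of the crux `CoherentScaleExclusion` (S2, item
stmt-NavierStokesRegularity-1423): closed composition of the birth skeleton and the dominations

Pure logic plus one elementary measure bound, landed `--supports stmt-NavierStokesRegularity-1423`
by the line lead of `Cruxes/CoherentScaleExclusion/Lines/birth.lean`.

Write `C(r) = cknC r (T,x₀) u` (scaled `L³` load on the backward cylinder `Q_r(T,x₀)`),
`MIX(r,δ)` for the scalar dissipation test of the route file (every smooth, uniformly rapidly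
decaying `θ` solving `∂ₜθ + u·∇θ = Δθ` on `[T-r², T-r²/2] × ℝ³` with `supp θ(T-r²) ⊆ B_r(x₀)` keeps
at most the fraction `δ²` of `∫ θ²`), `Recur(M,δ)` for "for every `r₀ > 0` some `r ∈ (0,r₀)` has
`ofReal M ≤ C(r)` and `¬ MIX(r,δ)`", and `BDD` for "`u` is bounded on some `(T-ρ²,T) × B_ρ(x₀)`".
The crux S2 reads `∀ δ > 0, ∃ M, ∀ (classical Leray–Hopf `u` from a rapidly decaying datum) ∀ x₀,
Recur(M,δ) → BDD`.

## Contents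

* `coherentScaleExclusion_cknC_le_of_bound`, `coherentScaleExclusion_loadCeiling_of_bdd` —
  `BDD ⇒ C(r) ≤ ofReal (K₊³ r³ |B₁|)` for `r < ρ`, hence a load ceiling near `0`
  (from the tree's `SereginSverak2009.cknC_le_of_ae_bound`).
* `coherentScaleExclusion_not_recur_of_bdd` — `BDD ∧ 0 < M ⇒ ¬ Recur(M,δ)`: the conclusion of S2
  refutes its own antecedent, so S2 is a nonexistence statement;
  `coherentScaleExclusion_iff_nonexistence` records `S2 ↔ ∀ δ > 0, ∃ M, … Recur(M,δ) → False`.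
* The three regimes of the load profile `r ↦ C(r)` at the point (the registered stubs of the birth
  line, here as HYPOTHESES, never asserted): (A) ceiling `C ≤ M₁` near `0`; (I) windows
  `liminf C < ∞` with unbounded load; (B) pure cascade `C → ∞`.
  `coherentScaleExclusion_of_regimes : (A) → (I) → (B) → CoherentScaleExclusion` is the closed twin
  of the skeleton theorem `CoherentScaleExclusion_of` (same proof: `M := max M_A M_I`, recurrence
  is antitone in the threshold, trichotomy by two uses of excluded middle).
* Dominations by the sibling crux S1 = `SequentialTypeIExclusion` (item 1424):
  `coherentTypeIRegime_of_sequentialTypeIExclusion : S1 → (A)` (a ceiling makes the bounded-load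
  scales cofinal) and `coherentWindowRegime_of_sequentialTypeIExclusion : S1 → (I)` (S1 gives BDD,
  the load ceiling contradicts unbounded load). Hence
  `coherentScaleExclusion_of_sequentialTypeIExclusion_of_cascade : S1 → (B) → CoherentScaleExclusion`:
  MODULO S1 — which the route's deciding theorem consumes anyway — THE CRUX IS THE CASCADE REGIME (B).

Nothing here is new mathematics; the open content of S2 is regime (B) (and, without S1, the
coherent Type-I Liouville problem behind (A) and the Type-I-window exclusion behind (I)).
-/

noncomputable section

namespace Summit.NavierStokesRegularity.NavierStokesRegularity.Theorems

-- single-conjunct summit (`<Problem> = <Summit>`): the duplicated namespace component is by design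
-- (lakefile sets the same option tree-wide)
set_option linter.dupNamespace false

open MeasureTheory Filter Set Metric
open Literature.Analysis.FluidPDE Literature.Analysis.FluidPDE.SereginSverak2009
open Summit.NavierStokesRegularity.NavierStokesRegularity.Theses.SelfMixingDichotomy

/-- **Cubic load under a pointwise bound.** If `‖u‖ ≤ K` on `(T-ρ²,T) × B_ρ(x₀)` and `0 < r < ρ`,
then `C(r) = cknC r (T,x₀) u ≤ ofReal (K₊³ r³ |B₁|)`, `K₊ = max K 0` (`cknC_le_of_ae_bound`:
`|Q_r| = r⁵ |B₁|`). [folklore] -/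
theorem coherentScaleExclusion_cknC_le_of_bound
    {u : ℝ → EuclideanSpace ℝ (Fin 3) → EuclideanSpace ℝ (Fin 3)} {T ρ K r : ℝ}
    {x₀ : EuclideanSpace ℝ (Fin 3)}
    (hK : ∀ t ∈ Set.Ioo (T - ρ ^ 2) T, ∀ x ∈ Metric.ball x₀ ρ, ‖u t x‖ ≤ K)
    (hr : 0 < r) (hrρ : r < ρ) :
    cknC r ((T, x₀) : ℝ × EuclideanSpace ℝ (Fin 3)) u ≤
      ENNReal.ofReal ((max K 0) ^ 3 * r ^ 3 * (volume (ball (0 : EuclideanSpace ℝ (Fin 3)) 1)).toReal) := by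
  have hB : volume (ball (0 : EuclideanSpace ℝ (Fin 3)) 1) ≠ ⊤ := measure_ball_lt_top.ne
  have hK0 : 0 ≤ max K 0 := le_max_right _ _
  -- `‖u‖ ≤ max K 0` everywhere on `Q_r(T,x₀) ⊆ (T-ρ²,T) × B_ρ(x₀)`
  have hbd : ∀ᵐ z ∂(volume.restrict (parabolicCylinder r ((T, x₀) : ℝ × EuclideanSpace ℝ (Fin 3)))),
      ‖u z.1 z.2‖ ≤ max K 0 := by
    refine ae_restrict_of_forall_mem (isOpen_parabolicCylinder _ _).measurableSet ?_
    rintro ⟨t, x⟩ hz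
    rw [mem_parabolicCylinder] at hz
    obtain ⟨⟨ht1, ht2⟩, hx⟩ := hz
    have hr2 : r ^ 2 < ρ ^ 2 := by nlinarith
    refine (hK t ⟨by simpa using by linarith, ht2⟩ x ?_).trans (le_max_left _ _)
    exact mem_ball.2 (lt_trans hx hrρ)
  have h3 : 0 ≤ (max K 0) ^ 3 * r ^ 3 := mul_nonneg (pow_nonneg hK0 3) (pow_nonneg hr.le 3)
  calc cknC r ((T, x₀) : ℝ × EuclideanSpace ℝ (Fin 3)) u
      ≤ ENNReal.ofReal ((max K 0) ^ 3 * r ^ 3) * volume (ball (0 : EuclideanSpace ℝ (Fin 3)) 1) :=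
        cknC_le_of_ae_bound hr hK0 hbd
    _ = ENNReal.ofReal ((max K 0) ^ 3 * r ^ 3) *
          ENNReal.ofReal (volume (ball (0 : EuclideanSpace ℝ (Fin 3)) 1)).toReal := by
        rw [ENNReal.ofReal_toReal hB]
    _ = ENNReal.ofReal ((max K 0) ^ 3 * r ^ 3 * (volume (ball (0 : EuclideanSpace ℝ (Fin 3)) 1)).toReal) :=
        (ENNReal.ofReal_mul h3).symm

/-- **Load ceiling under boundedness.** If `u` is bounded on some `(T-ρ²,T) × B_ρ(x₀)` (`BDD`),
then the scaled cubic load `C(r) = cknC r (T,x₀) u` is bounded for `0 < r < ρ`: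
`C(r) ≤ |B₁| K₊³ r³ ≤ |B₁| K₊³ ρ³`. [folklore] -/
theorem coherentScaleExclusion_loadCeiling_of_bdd
    {u : ℝ → EuclideanSpace ℝ (Fin 3) → EuclideanSpace ℝ (Fin 3)} {T : ℝ}
    {x₀ : EuclideanSpace ℝ (Fin 3)}
    (hbdd : ∃ ρ : ℝ, 0 < ρ ∧ ∃ M : ℝ, ∀ t ∈ Set.Ioo (T - ρ ^ 2) T, ∀ x ∈ Metric.ball x₀ ρ,
      ‖u t x‖ ≤ M) :
    ∃ M₁ r₁ : ℝ, 0 < r₁ ∧ ∀ r ∈ Set.Ioo 0 r₁,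
      cknC r ((T, x₀) : ℝ × EuclideanSpace ℝ (Fin 3)) u ≤ ENNReal.ofReal M₁ := by
  obtain ⟨ρ, hρ, K, hK⟩ := hbdd
  refine ⟨(max K 0) ^ 3 * ρ ^ 3 * (volume (ball (0 : EuclideanSpace ℝ (Fin 3)) 1)).toReal, ρ, hρ,
    fun r hr => (coherentScaleExclusion_cknC_le_of_bound hK hr.1 hr.2).trans
      (ENNReal.ofReal_le_ofReal ?_)⟩
  have hr3 : r ^ 3 ≤ ρ ^ 3 := pow_le_pow_left₀ hr.1.le hr.2.le 3
  have hv : 0 ≤ (volume (ball (0 : EuclideanSpace ℝ (Fin 3)) 1)).toReal := ENNReal.toReal_nonneg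
  have h3 : 0 ≤ (max K 0) ^ 3 := pow_nonneg (le_max_right _ _) 3
  exact mul_le_mul_of_nonneg_right (mul_le_mul_of_nonneg_left hr3 h3) hv

/-- **The conclusion of S2 refutes its antecedent.** If `u` is bounded near `(T,x₀)` and `0 < M`,
then `M`-loaded scales (whatever the extra property `P`, e.g. non-mixing) do not recur at
`(T,x₀)`: `C(r) ≤ |B₁| K₊³ r³ < M` for small `r`. [folklore] -/
theorem coherentScaleExclusion_not_recur_of_bdd
    {u : ℝ → EuclideanSpace ℝ (Fin 3) → EuclideanSpace ℝ (Fin 3)} {T M : ℝ}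
    {x₀ : EuclideanSpace ℝ (Fin 3)} {P : ℝ → Prop} (hM : 0 < M)
    (hbdd : ∃ ρ : ℝ, 0 < ρ ∧ ∃ M : ℝ, ∀ t ∈ Set.Ioo (T - ρ ^ 2) T, ∀ x ∈ Metric.ball x₀ ρ,
      ‖u t x‖ ≤ M) :
    ¬ (∀ r₀ : ℝ, 0 < r₀ → ∃ r ∈ Set.Ioo 0 r₀,
        ENNReal.ofReal M ≤ cknC r ((T, x₀) : ℝ × EuclideanSpace ℝ (Fin 3)) u ∧ P r) := by
  intro hrec
  obtain ⟨ρ, hρ, K, hK⟩ := hbdd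
  have hK0 : 0 ≤ max K 0 := le_max_right _ _
  set V : ℝ := (volume (ball (0 : EuclideanSpace ℝ (Fin 3)) 1)).toReal with hV
  have hv : 0 ≤ V := ENNReal.toReal_nonneg
  -- choose `r₀ ≤ min ρ 1` with `a r₀ < M`, `a = |B₁| K₊³`; then `a r³ ≤ a r < M` for `r < r₀`
  set a : ℝ := (max K 0) ^ 3 * V with ha
  have ha0 : 0 ≤ a := mul_nonneg (pow_nonneg hK0 3) hv
  have hden : 0 < 2 * (a + 1) := by positivity
  obtain ⟨r, hr, hload, -⟩ := hrec (min (min ρ 1) (M / (2 * (a + 1))))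
    (lt_min (lt_min hρ one_pos) (div_pos hM hden))
  have hrρ : r < ρ := lt_of_lt_of_le hr.2 ((min_le_left _ _).trans (min_le_left _ _))
  have hr1 : r < 1 := lt_of_lt_of_le hr.2 ((min_le_left _ _).trans (min_le_right _ _))
  have hrM : r < M / (2 * (a + 1)) := lt_of_lt_of_le hr.2 (min_le_right _ _)
  have hC := hload.trans (coherentScaleExclusion_cknC_le_of_bound hK hr.1 hrρ)
  have h3 : 0 ≤ (max K 0) ^ 3 * r ^ 3 * V :=
    mul_nonneg (mul_nonneg (pow_nonneg hK0 3) (pow_nonneg hr.1.le 3)) hv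
  have hC' : M ≤ (max K 0) ^ 3 * r ^ 3 * V := (ENNReal.ofReal_le_ofReal_iff h3).1 hC
  -- `M ≤ a r³ ≤ a r < M/2 + …`: contradiction
  have hr3 : r ^ 3 ≤ r := by nlinarith [hr.1, hr1, mul_pos hr.1 hr.1]
  have h1 : (max K 0) ^ 3 * r ^ 3 * V ≤ a * r := by
    have := mul_le_mul_of_nonneg_left hr3 ha0
    calc (max K 0) ^ 3 * r ^ 3 * V = a * r ^ 3 := by rw [ha]; ring
      _ ≤ a * r := this
  have h2 : a * r < M := by
    have h := (lt_div_iff₀ hden).1 hrM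
    nlinarith [ha0, hr.1]
  linarith

/-- **S2 is a nonexistence statement** (refuter's structure note made durable): since `BDD` with a
positive threshold refutes recurrence (`coherentScaleExclusion_not_recur_of_bdd`) and recurrence is
antitone in the threshold, `CoherentScaleExclusion` is equivalent to: for every `δ > 0` there is `M`
such that NO finite-energy classical solution from a rapidly decaying datum has a final-time point
with recurrent `M`-loaded non-`δ`-mixing scales. [folklore] -/
theorem coherentScaleExclusion_iff_nonexistence :
    CoherentScaleExclusion ↔
    ∀ δ : ℝ, 0 < δ → ∃ M : ℝ, ∀ T : ℝ, 0 < T →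
      ∀ (u : ℝ → EuclideanSpace ℝ (Fin 3) → EuclideanSpace ℝ (Fin 3)) (p : ℝ → EuclideanSpace ℝ (Fin 3) → ℝ),
      IsClassicalNSSolutionOn (Set.Ico 0 T) 1 0 u p →
      IsLerayHopfOn T 1 0 (u 0) u →
      HasRapidSpatialDecay (u 0) →
      ∀ x₀ : EuclideanSpace ℝ (Fin 3),
      (∀ r₀ : ℝ, 0 < r₀ → ∃ r ∈ Set.Ioo 0 r₀,
          ENNReal.ofReal M ≤ cknC r ((T, x₀) : ℝ × EuclideanSpace ℝ (Fin 3)) u ∧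
          ¬ (∀ θ : ℝ → EuclideanSpace ℝ (Fin 3) → ℝ,
              IsSmoothSpaceTimeOn (Set.Icc (T - r ^ 2) (T - r ^ 2 / 2)) θ →
              HasUniformRapidDecayOn (Set.Icc (T - r ^ 2) (T - r ^ 2 / 2)) θ →
              (∀ t ∈ (Set.Icc (T - r ^ 2) (T - r ^ 2 / 2)), ∀ x : EuclideanSpace ℝ (Fin 3),
                timeDerivWithin (Set.Icc (T - r ^ 2) (T - r ^ 2 / 2)) θ t x +
                  inner ℝ (u t x) (gradient (θ t) x) = Laplacian.laplacian (θ t) x) →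
              Function.support (θ (T - r ^ 2)) ⊆ Metric.ball x₀ r →
              ∫ x, (θ (T - r ^ 2 / 2) x) ^ 2 ≤ δ ^ 2 * ∫ x, (θ (T - r ^ 2) x) ^ 2)) →
      False := by
  unfold CoherentScaleExclusion
  constructor
  · intro h δ hδ
    obtain ⟨M, hM⟩ := h δ hδ
    refine ⟨max M 1, fun T hT u p hcl hLH hdec x₀ hrec => ?_⟩
    have hbdd := hM T hT u p hcl hLH hdec x₀ (fun r₀ hr₀ => (hrec r₀ hr₀).imp fun r hr =>
      ⟨hr.1, le_trans (ENNReal.ofReal_le_ofReal (le_max_left M 1)) hr.2.1, hr.2.2⟩)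
    exact coherentScaleExclusion_not_recur_of_bdd (lt_of_lt_of_le one_pos (le_max_right M 1)) hbdd hrec
  · intro h δ hδ
    obtain ⟨M, hM⟩ := h δ hδ
    exact ⟨M, fun T hT u p hcl hLH hdec x₀ hrec => (hM T hT u p hcl hLH hdec x₀ hrec).elim⟩

/-- **Closed twin of the birth skeleton** `Cruxes/CoherentScaleExclusion/Lines/birth.lean`: the
three registered stub STATEMENTS — regime (A) `stub_coherentTypeIExclusion` (Type-I ceiling),
regime (I) `stub_coherentWindowExclusion` (Type-I windows with unbounded load), regime (B)
`stub_coherentCascadeExclusion` (pure cascade) — as hypotheses imply the crux by name. Same proof as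
the skeleton theorem `CoherentScaleExclusion_of`: `M := max M_A M_I`; recurrence is antitone in the
threshold (`ENNReal.ofReal_le_ofReal`); the load profile at the point is a pure cascade, or has a
ceiling, or has windows and unbounded load (two uses of excluded middle). [folklore] -/
theorem coherentScaleExclusion_of_regimes
    (hA : ∀ δ : ℝ, 0 < δ → ∃ M : ℝ, ∀ T : ℝ, 0 < T →
      ∀ (u : ℝ → EuclideanSpace ℝ (Fin 3) → EuclideanSpace ℝ (Fin 3)) (p : ℝ → EuclideanSpace ℝ (Fin 3) → ℝ),
      IsClassicalNSSolutionOn (Set.Ico 0 T) 1 0 u p →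
      IsLerayHopfOn T 1 0 (u 0) u →
      HasRapidSpatialDecay (u 0) →
      ∀ x₀ : EuclideanSpace ℝ (Fin 3),
      (∃ M₁ r₁ : ℝ, 0 < r₁ ∧ ∀ r ∈ Set.Ioo 0 r₁,
          cknC r ((T, x₀) : ℝ × EuclideanSpace ℝ (Fin 3)) u ≤ ENNReal.ofReal M₁) →
      (∀ r₀ : ℝ, 0 < r₀ → ∃ r ∈ Set.Ioo 0 r₀,
          ENNReal.ofReal M ≤ cknC r ((T, x₀) : ℝ × EuclideanSpace ℝ (Fin 3)) u ∧
          ¬ (∀ θ : ℝ → EuclideanSpace ℝ (Fin 3) → ℝ,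
              IsSmoothSpaceTimeOn (Set.Icc (T - r ^ 2) (T - r ^ 2 / 2)) θ →
              HasUniformRapidDecayOn (Set.Icc (T - r ^ 2) (T - r ^ 2 / 2)) θ →
              (∀ t ∈ (Set.Icc (T - r ^ 2) (T - r ^ 2 / 2)), ∀ x : EuclideanSpace ℝ (Fin 3),
                timeDerivWithin (Set.Icc (T - r ^ 2) (T - r ^ 2 / 2)) θ t x +
                  inner ℝ (u t x) (gradient (θ t) x) = Laplacian.laplacian (θ t) x) →
              Function.support (θ (T - r ^ 2)) ⊆ Metric.ball x₀ r →
              ∫ x, (θ (T - r ^ 2 / 2) x) ^ 2 ≤ δ ^ 2 * ∫ x, (θ (T - r ^ 2) x) ^ 2)) →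
      (∃ ρ : ℝ, 0 < ρ ∧ ∃ M : ℝ, ∀ t ∈ Set.Ioo (T - ρ ^ 2) T, ∀ x ∈ Metric.ball x₀ ρ, ‖u t x‖ ≤ M))
    (hI : ∀ δ : ℝ, 0 < δ → ∃ M : ℝ, ∀ T : ℝ, 0 < T →
      ∀ (u : ℝ → EuclideanSpace ℝ (Fin 3) → EuclideanSpace ℝ (Fin 3)) (p : ℝ → EuclideanSpace ℝ (Fin 3) → ℝ),
      IsClassicalNSSolutionOn (Set.Ico 0 T) 1 0 u p →
      IsLerayHopfOn T 1 0 (u 0) u →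
      HasRapidSpatialDecay (u 0) →
      ∀ x₀ : EuclideanSpace ℝ (Fin 3),
      (∃ M' : ℝ, ∀ r₁ : ℝ, 0 < r₁ → ∃ r ∈ Set.Ioo 0 r₁,
          cknC r ((T, x₀) : ℝ × EuclideanSpace ℝ (Fin 3)) u ≤ ENNReal.ofReal M') →
      (∀ M'' r₁ : ℝ, 0 < r₁ → ∃ r ∈ Set.Ioo 0 r₁,
          ENNReal.ofReal M'' < cknC r ((T, x₀) : ℝ × EuclideanSpace ℝ (Fin 3)) u) →
      (∀ r₀ : ℝ, 0 < r₀ → ∃ r ∈ Set.Ioo 0 r₀,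
          ENNReal.ofReal M ≤ cknC r ((T, x₀) : ℝ × EuclideanSpace ℝ (Fin 3)) u ∧
          ¬ (∀ θ : ℝ → EuclideanSpace ℝ (Fin 3) → ℝ,
              IsSmoothSpaceTimeOn (Set.Icc (T - r ^ 2) (T - r ^ 2 / 2)) θ →
              HasUniformRapidDecayOn (Set.Icc (T - r ^ 2) (T - r ^ 2 / 2)) θ →
              (∀ t ∈ (Set.Icc (T - r ^ 2) (T - r ^ 2 / 2)), ∀ x : EuclideanSpace ℝ (Fin 3),
                timeDerivWithin (Set.Icc (T - r ^ 2) (T - r ^ 2 / 2)) θ t x +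
                  inner ℝ (u t x) (gradient (θ t) x) = Laplacian.laplacian (θ t) x) →
              Function.support (θ (T - r ^ 2)) ⊆ Metric.ball x₀ r →
              ∫ x, (θ (T - r ^ 2 / 2) x) ^ 2 ≤ δ ^ 2 * ∫ x, (θ (T - r ^ 2) x) ^ 2)) →
      False)
    (hB : ∀ δ : ℝ, 0 < δ → ∀ T : ℝ, 0 < T →
      ∀ (u : ℝ → EuclideanSpace ℝ (Fin 3) → EuclideanSpace ℝ (Fin 3)) (p : ℝ → EuclideanSpace ℝ (Fin 3) → ℝ),
      IsClassicalNSSolutionOn (Set.Ico 0 T) 1 0 u p →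
      IsLerayHopfOn T 1 0 (u 0) u →
      HasRapidSpatialDecay (u 0) →
      ∀ x₀ : EuclideanSpace ℝ (Fin 3),
      (∀ M' : ℝ, ∃ r₁ : ℝ, 0 < r₁ ∧ ∀ r ∈ Set.Ioo 0 r₁,
          ENNReal.ofReal M' ≤ cknC r ((T, x₀) : ℝ × EuclideanSpace ℝ (Fin 3)) u) →
      (∀ r₀ : ℝ, 0 < r₀ → ∃ r ∈ Set.Ioo 0 r₀,
          ¬ (∀ θ : ℝ → EuclideanSpace ℝ (Fin 3) → ℝ,
              IsSmoothSpaceTimeOn (Set.Icc (T - r ^ 2) (T - r ^ 2 / 2)) θ →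
              HasUniformRapidDecayOn (Set.Icc (T - r ^ 2) (T - r ^ 2 / 2)) θ →
              (∀ t ∈ (Set.Icc (T - r ^ 2) (T - r ^ 2 / 2)), ∀ x : EuclideanSpace ℝ (Fin 3),
                timeDerivWithin (Set.Icc (T - r ^ 2) (T - r ^ 2 / 2)) θ t x +
                  inner ℝ (u t x) (gradient (θ t) x) = Laplacian.laplacian (θ t) x) →
              Function.support (θ (T - r ^ 2)) ⊆ Metric.ball x₀ r →
              ∫ x, (θ (T - r ^ 2 / 2) x) ^ 2 ≤ δ ^ 2 * ∫ x, (θ (T - r ^ 2) x) ^ 2)) →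
      False) :
    CoherentScaleExclusion := by
  intro δ hδ
  obtain ⟨MA, hMA⟩ := hA δ hδ
  obtain ⟨MI, hMI⟩ := hI δ hδ
  refine ⟨max MA MI, ?_⟩
  intro T hT u p hcl hLH hdec x₀ hRec
  -- regime (B): the load diverges along all small scales — the threshold is irrelevant
  by_cases hcasc : ∀ M' : ℝ, ∃ r₁ : ℝ, 0 < r₁ ∧ ∀ r ∈ Set.Ioo 0 r₁,
      ENNReal.ofReal M' ≤ cknC r ((T, x₀) : ℝ × EuclideanSpace ℝ (Fin 3)) u
  · exact (hB δ hδ T hT u p hcl hLH hdec x₀ hcasc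
      (fun r₀ hr₀ => (hRec r₀ hr₀).imp fun r hr => ⟨hr.1, hr.2.2⟩)).elim
  -- otherwise bounded-load scales recur: `liminf C < ∞`
  have hwin : ∃ M' : ℝ, ∀ r₁ : ℝ, 0 < r₁ → ∃ r ∈ Set.Ioo 0 r₁,
      cknC r ((T, x₀) : ℝ × EuclideanSpace ℝ (Fin 3)) u ≤ ENNReal.ofReal M' := by
    push Not at hcasc
    obtain ⟨M', hM'⟩ := hcasc
    exact ⟨M', fun r₁ hr₁ => (hM' r₁ hr₁).imp fun r hr => ⟨hr.1, hr.2.le⟩⟩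
  -- regime (A): a Type-I ceiling at the point
  by_cases hceil : ∃ M₁ r₁ : ℝ, 0 < r₁ ∧ ∀ r ∈ Set.Ioo 0 r₁,
      cknC r ((T, x₀) : ℝ × EuclideanSpace ℝ (Fin 3)) u ≤ ENNReal.ofReal M₁
  · exact hMA T hT u p hcl hLH hdec x₀ hceil
      (fun r₀ hr₀ => (hRec r₀ hr₀).imp fun r hr =>
        ⟨hr.1, le_trans (ENNReal.ofReal_le_ofReal (le_max_left MA MI)) hr.2.1, hr.2.2⟩)
  -- regime (I): windows recur but the load is unbounded
  have hunb : ∀ M'' r₁ : ℝ, 0 < r₁ → ∃ r ∈ Set.Ioo 0 r₁,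
      ENNReal.ofReal M'' < cknC r ((T, x₀) : ℝ × EuclideanSpace ℝ (Fin 3)) u := by
    push Not at hceil
    exact fun M'' r₁ hr₁ => hceil M'' r₁ hr₁
  exact (hMI T hT u p hcl hLH hdec x₀ hwin hunb
    (fun r₀ hr₀ => (hRec r₀ hr₀).imp fun r hr =>
      ⟨hr.1, le_trans (ENNReal.ofReal_le_ofReal (le_max_right MA MI)) hr.2.1, hr.2.2⟩)).elim

/-- **Domination of regime (A) by S1.** `SequentialTypeIExclusion` (the sibling crux S1: recurrent
bounded-load scales at a point force boundedness) implies the statement of the registered stub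
`stub_coherentTypeIExclusion` outright, with `M := 0` and without using coherence: under a ceiling
`C(r) ≤ ofReal M₁` on `(0,r₁)` the bounded-load scales are cofinal, and S1 at threshold `M₁` gives
`BDD`. [folklore] -/
theorem coherentTypeIRegime_of_sequentialTypeIExclusion (hS1 : SequentialTypeIExclusion) :
    ∀ δ : ℝ, 0 < δ → ∃ M : ℝ, ∀ T : ℝ, 0 < T →
      ∀ (u : ℝ → EuclideanSpace ℝ (Fin 3) → EuclideanSpace ℝ (Fin 3)) (p : ℝ → EuclideanSpace ℝ (Fin 3) → ℝ),
      IsClassicalNSSolutionOn (Set.Ico 0 T) 1 0 u p →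
      IsLerayHopfOn T 1 0 (u 0) u →
      HasRapidSpatialDecay (u 0) →
      ∀ x₀ : EuclideanSpace ℝ (Fin 3),
      (∃ M₁ r₁ : ℝ, 0 < r₁ ∧ ∀ r ∈ Set.Ioo 0 r₁,
          cknC r ((T, x₀) : ℝ × EuclideanSpace ℝ (Fin 3)) u ≤ ENNReal.ofReal M₁) →
      (∀ r₀ : ℝ, 0 < r₀ → ∃ r ∈ Set.Ioo 0 r₀,
          ENNReal.ofReal M ≤ cknC r ((T, x₀) : ℝ × EuclideanSpace ℝ (Fin 3)) u ∧
          ¬ (∀ θ : ℝ → EuclideanSpace ℝ (Fin 3) → ℝ,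
              IsSmoothSpaceTimeOn (Set.Icc (T - r ^ 2) (T - r ^ 2 / 2)) θ →
              HasUniformRapidDecayOn (Set.Icc (T - r ^ 2) (T - r ^ 2 / 2)) θ →
              (∀ t ∈ (Set.Icc (T - r ^ 2) (T - r ^ 2 / 2)), ∀ x : EuclideanSpace ℝ (Fin 3),
                timeDerivWithin (Set.Icc (T - r ^ 2) (T - r ^ 2 / 2)) θ t x +
                  inner ℝ (u t x) (gradient (θ t) x) = Laplacian.laplacian (θ t) x) →
              Function.support (θ (T - r ^ 2)) ⊆ Metric.ball x₀ r →
              ∫ x, (θ (T - r ^ 2 / 2) x) ^ 2 ≤ δ ^ 2 * ∫ x, (θ (T - r ^ 2) x) ^ 2)) →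
      (∃ ρ : ℝ, 0 < ρ ∧ ∃ M : ℝ, ∀ t ∈ Set.Ioo (T - ρ ^ 2) T, ∀ x ∈ Metric.ball x₀ ρ, ‖u t x‖ ≤ M) := by
  intro δ _hδ
  refine ⟨0, fun T hT u p hcl hLH hdec x₀ hceil _hrec => ?_⟩
  obtain ⟨M₁, r₁, hr₁, hC⟩ := hceil
  refine hS1 M₁ T hT u p hcl hLH hdec x₀ fun r₀ hr₀ => ?_
  refine ⟨min r₀ r₁ / 2, ⟨by positivity, ?_⟩, hC _ ⟨by positivity, ?_⟩⟩
  · linarith [min_le_left r₀ r₁, lt_min hr₀ hr₁]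
  · linarith [min_le_right r₀ r₁, lt_min hr₀ hr₁]

/-- **Domination of regime (I) by S1.** `SequentialTypeIExclusion` implies the statement of the
registered stub `stub_coherentWindowExclusion` (with `M := 0`, coherence unused): recurrent
bounded-load scales `C(r) ≤ ofReal M'` give `BDD` by S1, hence a load ceiling
(`coherentScaleExclusion_loadCeiling_of_bdd`), which the unbounded-load hypothesis violates. [folklore] -/
theorem coherentWindowRegime_of_sequentialTypeIExclusion (hS1 : SequentialTypeIExclusion) :
    ∀ δ : ℝ, 0 < δ → ∃ M : ℝ, ∀ T : ℝ, 0 < T →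
      ∀ (u : ℝ → EuclideanSpace ℝ (Fin 3) → EuclideanSpace ℝ (Fin 3)) (p : ℝ → EuclideanSpace ℝ (Fin 3) → ℝ),
      IsClassicalNSSolutionOn (Set.Ico 0 T) 1 0 u p →
      IsLerayHopfOn T 1 0 (u 0) u →
      HasRapidSpatialDecay (u 0) →
      ∀ x₀ : EuclideanSpace ℝ (Fin 3),
      (∃ M' : ℝ, ∀ r₁ : ℝ, 0 < r₁ → ∃ r ∈ Set.Ioo 0 r₁,
          cknC r ((T, x₀) : ℝ × EuclideanSpace ℝ (Fin 3)) u ≤ ENNReal.ofReal M') →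
      (∀ M'' r₁ : ℝ, 0 < r₁ → ∃ r ∈ Set.Ioo 0 r₁,
          ENNReal.ofReal M'' < cknC r ((T, x₀) : ℝ × EuclideanSpace ℝ (Fin 3)) u) →
      (∀ r₀ : ℝ, 0 < r₀ → ∃ r ∈ Set.Ioo 0 r₀,
          ENNReal.ofReal M ≤ cknC r ((T, x₀) : ℝ × EuclideanSpace ℝ (Fin 3)) u ∧
          ¬ (∀ θ : ℝ → EuclideanSpace ℝ (Fin 3) → ℝ,
              IsSmoothSpaceTimeOn (Set.Icc (T - r ^ 2) (T - r ^ 2 / 2)) θ →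
              HasUniformRapidDecayOn (Set.Icc (T - r ^ 2) (T - r ^ 2 / 2)) θ →
              (∀ t ∈ (Set.Icc (T - r ^ 2) (T - r ^ 2 / 2)), ∀ x : EuclideanSpace ℝ (Fin 3),
                timeDerivWithin (Set.Icc (T - r ^ 2) (T - r ^ 2 / 2)) θ t x +
                  inner ℝ (u t x) (gradient (θ t) x) = Laplacian.laplacian (θ t) x) →
              Function.support (θ (T - r ^ 2)) ⊆ Metric.ball x₀ r →
              ∫ x, (θ (T - r ^ 2 / 2) x) ^ 2 ≤ δ ^ 2 * ∫ x, (θ (T - r ^ 2) x) ^ 2)) →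
      False := by
  intro δ _hδ
  refine ⟨0, fun T hT u p hcl hLH hdec x₀ hwin hunb _hrec => ?_⟩
  obtain ⟨M', hM'⟩ := hwin
  have hbdd := hS1 M' T hT u p hcl hLH hdec x₀ hM'
  obtain ⟨M₁, r₁, hr₁, hC⟩ := coherentScaleExclusion_loadCeiling_of_bdd hbdd
  obtain ⟨r, hr, hlt⟩ := hunb M₁ r₁ hr₁
  exact absurd (hC r hr) (not_le.2 hlt)

/-- **Route note: modulo S1 the crux is the cascade regime.** `SequentialTypeIExclusion` together
with the statement of the registered stub `stub_coherentCascadeExclusion` (regime (B): for every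
`δ > 0`, no final-time point of a finite-energy classical solution from a rapidly decaying datum
has `C(r) → ∞` along all small scales while non-`δ`-mixing scales recur) implies
`CoherentScaleExclusion` — by `coherentScaleExclusion_of_regimes` with regimes (A) and (I)
supplied by the two dominations. Since the route's deciding theorem consumes S1 anyway, the content
S2 adds to the route is exactly regime (B). [folklore] -/
theorem coherentScaleExclusion_of_sequentialTypeIExclusion_of_cascade :
    Summit.NavierStokesRegularity.NavierStokesRegularity.Theses.SelfMixingDichotomy.SequentialTypeIExclusion → (∀ δ : ℝ, 0 < δ → ∀ T : ℝ, 0 < T → ∀ (u : ℝ → EuclideanSpace ℝ (Fin 3) → EuclideanSpace ℝ (Fin 3)) (p : ℝ → EuclideanSpace ℝ (Fin 3) → ℝ), Literature.Analysis.FluidPDE.IsClassicalNSSolutionOn (Set.Ico 0 T) 1 0 u p → Literature.Analysis.FluidPDE.IsLerayHopfOn T 1 0 (u 0) u → Literature.Analysis.FluidPDE.HasRapidSpatialDecay (u 0) → ∀ x₀ : EuclideanSpace ℝ (Fin 3), (∀ M' : ℝ, ∃ r₁ : ℝ, 0 < r₁ ∧ ∀ r ∈ Set.Ioo 0 r₁,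 ENNReal.ofReal M' ≤ Literature.Analysis.FluidPDE.cknC r ((T, x₀) : ℝ × EuclideanSpace ℝ (Fin 3)) u) → (∀ r₀ : ℝ, 0 < r₀ → ∃ r ∈ Set.Ioo 0 r₀, ¬ (∀ θ : ℝ → EuclideanSpace ℝ (Fin 3) → ℝ, Literature.Analysis.FluidPDE.IsSmoothSpaceTimeOn (Set.Icc (T - r ^ 2) (T - r ^ 2 / 2)) θ → Literature.Analysis.FluidPDE.HasUniformRapidDecayOn (Set.Icc (T - r ^ 2) (T - r ^ 2 / 2)) θ → (∀ t ∈ (Set.Icc (T - r ^ 2) (T - r ^ 2 / 2)), ∀ x : EuclideanSpace ℝ (Fin 3), Literature.Analysis.FluidPDE.timeDerivWithin (Set.Icc (T - r ^ 2) (T - r ^ 2 / 2)) θ t x + inner ℝ (u t x) (gradient (θ t) x) = Laplacian.laplacian (θ t) x) → Function.support (θ (T - r ^ 2)) ⊆ Metric.ball x₀ r → ∫ x, (θ (T - r ^ 2 / 2) x) ^ 2 ≤ δ ^ 2 * ∫ x, (θ (T - r ^ 2) x) ^ 2)) → False) → Summit.NavierStokesRegularity.NavierStokesRegularity.Theses.SelfMixingDichotomy.CoherentScaleExclusion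 :=
  fun hS1 hB => coherentScaleExclusion_of_regimes (coherentTypeIRegime_of_sequentialTypeIExclusion hS1)
    (coherentWindowRegime_of_sequentialTypeIExclusion hS1) hB

end Summit.NavierStokesRegularity.NavierStokesRegularity.Theorems
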